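import Summits.ABC.ABC.Theses.IneffectiveSubspace

/-!
# Complex-analytic core of the Thue–Roth stratum of the harmonic quartic family (stmt-ABC-14937)

Support file of line `SketchIdeator4` (crux `UniformSadicTowerFour`, card
`Cruxes/UniformSadicTowerFour/Ideas/gaussian-thue-pell-square.md`).  The companion file
`…HarmonicThueRoth.lean` proves THUE'S THEOREM for the harmonic quartic Thue equations
`Im(μ·ν⁴) = ±1` (`μ ∈ ℤ[i]` fixed, `Im μ ≠ 0`): finitely many `ν` — via Roth's theorem (proved in the
tree) applied root by root.  This file holds the four field-theoretic / metric lemmas it needs, all about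
complex numbers and all [folklore]:

* `pow_four_sub_pow_four_eq_prod` — `q⁴ − ζ₀⁴ = ∏_{k<4} (q − ζ₀·i^k)`.
* `sqrt_two_le_norm_root_sub_root` — two distinct fourth roots `ζ₀ i^a ≠ ζ₀ i^b` on the unit circle are
  `≥ √2` apart; `exists_near_fourth_root` — hence SOME fourth root `ζ` of `ζ₀⁴` has
  `‖q − ζ‖ ≤ 3·‖q⁴ − ζ₀⁴‖` (nearest-root separation).
* `norm_div_conj_sub_moebius` — the Möbius chart: for `z = e + fi ≠ 0` and real `α`,
  `‖z/z̄ − (α+i)/(α−i)‖ = 2|e − αf| / (‖z‖·‖α − i‖)`.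
* `moebius_alphaOf` / `isAlgebraic_alphaOf` — every `ζ ≠ 1` on the unit circle is `(α+i)/(α−i)` for the
  REAL number `α = 2·Im ζ/‖ζ − 1‖²` (written out; no auxiliary `def`), algebraic over `ℚ` when `ζ` is.
-/

-- `Summit.<Summit>.<Problem>` is the mandated summit-side namespace (CONVENTIONS §2); for the
-- single-conjunct summit `ABC` the two coincide, so the duplicate `ABC.ABC` is deliberate.
set_option linter.dupNamespace false

namespace Summit.ABC.ABC.Theorems.UniformSadicTowerFour.HarmonicThueRoth

open Complex
open scoped ComplexConjugate

/-! ## Fourth roots on the unit circle -/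

/-- `q⁴ − ζ₀⁴ = ∏_{k<4} (q − ζ₀·i^k)`. [folklore] -/
theorem pow_four_sub_pow_four_eq_prod (q ζ₀ : ℂ) :
    q ^ 4 - ζ₀ ^ 4 = ∏ k : Fin 4, (q - ζ₀ * I ^ (k : ℕ)) := by
  rw [Fin.prod_univ_four]
  simp only [Fin.val_zero, Fin.val_one, Fin.val_two, show ((3 : Fin 4) : ℕ) = 3 from rfl, pow_zero,
    pow_one, mul_one]
  have h2 : I ^ 2 = -1 := I_sq
  have h3 : I ^ 3 = -I := by rw [pow_succ, h2]; ring
  rw [h2, h3]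
  ring_nf
  rw [I_sq]
  ring

/-- Distinct powers `i^a ≠ i^b` (`a ≠ b < 4`) are at least `√2` apart: `2 ≤ ‖i^a − i^b‖²`. [folklore] -/
theorem two_le_normSq_I_pow_sub (a b : Fin 4) (hab : a ≠ b) :
    2 ≤ ‖I ^ (a : ℕ) - I ^ (b : ℕ)‖ ^ 2 := by
  have h2 : I ^ 2 = -1 := I_sq
  have h3 : I ^ 3 = -I := by rw [pow_succ, h2]; ring
  rw [Complex.sq_norm, Complex.normSq_apply]
  fin_cases a <;> fin_cases b <;>
    simp [h2, h3] at hab ⊢ <;> norm_num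

/-- Hence two distinct fourth roots `ζ₀ i^a`, `ζ₀ i^b` with `‖ζ₀‖ = 1` satisfy
`√2 ≤ ‖ζ₀ i^a − ζ₀ i^b‖`. [folklore] -/
theorem sqrt_two_le_norm_root_sub_root {ζ₀ : ℂ} (hζ₀ : ‖ζ₀‖ = 1) (a b : Fin 4) (hab : a ≠ b) :
    Real.sqrt 2 ≤ ‖ζ₀ * I ^ (a : ℕ) - ζ₀ * I ^ (b : ℕ)‖ := by
  rw [← mul_sub, norm_mul, hζ₀, one_mul]
  refine Real.sqrt_le_iff.mpr ⟨norm_nonneg _, ?_⟩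
  exact two_le_normSq_I_pow_sub a b hab

/-- **Nearest-root separation.** If `‖ζ₀‖ = 1` then for every `q ∈ ℂ` some fourth root
`ζ = ζ₀ i^k` of `ζ₀⁴` satisfies `‖q − ζ‖ ≤ 3·‖q⁴ − ζ₀⁴‖`: take the nearest root; every other root is
`≥ max(d, √2 − d) ≥ √2/2` away (`d` the nearest distance), so `‖q⁴ − ζ₀⁴‖ ≥ d·(√2/2)³ ≥ d/3`.
[folklore] -/
theorem exists_near_fourth_root {ζ₀ : ℂ} (hζ₀ : ‖ζ₀‖ = 1) (q : ℂ) :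
    ∃ k : Fin 4, ‖q - ζ₀ * Complex.I ^ (k : ℕ)‖ ≤ 3 * ‖q ^ 4 - ζ₀ ^ 4‖ := by
  -- the nearest root
  obtain ⟨k₀, -, hmin⟩ := Finset.exists_min_image Finset.univ
    (fun k : Fin 4 => ‖q - ζ₀ * I ^ (k : ℕ)‖) ⟨0, Finset.mem_univ _⟩
  refine ⟨k₀, ?_⟩
  set d : ℝ := ‖q - ζ₀ * I ^ (k₀ : ℕ)‖ with hd
  have hd0 : 0 ≤ d := norm_nonneg _
  -- every other root is at distance ≥ √2/2
  have hsqrt : Real.sqrt 2 / 2 ≤ 1 := by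
    rw [div_le_one (by norm_num : (0:ℝ) < 2)]
    have := Real.sqrt_le_sqrt (show (2:ℝ) ≤ 4 by norm_num)
    rwa [show (4:ℝ) = 2 ^ 2 by norm_num, Real.sqrt_sq (by norm_num)] at this
  have hsqrt0 : 0 < Real.sqrt 2 / 2 := by positivity
  have hother : ∀ k ∈ (Finset.univ.erase k₀ : Finset (Fin 4)),
      Real.sqrt 2 / 2 ≤ ‖q - ζ₀ * I ^ (k : ℕ)‖ := by
    intro k hk
    have hk' : k ≠ k₀ := Finset.ne_of_mem_erase hk
    have h1 : d ≤ ‖q - ζ₀ * I ^ (k : ℕ)‖ := hmin k (Finset.mem_univ _)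
    have h2 : Real.sqrt 2 ≤ ‖ζ₀ * I ^ (k : ℕ) - ζ₀ * I ^ (k₀ : ℕ)‖ :=
      sqrt_two_le_norm_root_sub_root hζ₀ k k₀ hk'
    have h3 : ‖ζ₀ * I ^ (k : ℕ) - ζ₀ * I ^ (k₀ : ℕ)‖ ≤ ‖q - ζ₀ * I ^ (k : ℕ)‖ + d := by
      calc ‖ζ₀ * I ^ (k : ℕ) - ζ₀ * I ^ (k₀ : ℕ)‖
          = ‖(q - ζ₀ * I ^ (k₀ : ℕ)) - (q - ζ₀ * I ^ (k : ℕ))‖ := by congr 1; ring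
        _ ≤ ‖q - ζ₀ * I ^ (k₀ : ℕ)‖ + ‖q - ζ₀ * I ^ (k : ℕ)‖ := norm_sub_le _ _
        _ = ‖q - ζ₀ * I ^ (k : ℕ)‖ + d := by rw [hd]; ring
    linarith
  -- the product over the other three roots is ≥ (√2/2)³
  have hprod : ‖q ^ 4 - ζ₀ ^ 4‖ = d * ∏ k ∈ Finset.univ.erase k₀, ‖q - ζ₀ * I ^ (k : ℕ)‖ := by
    rw [pow_four_sub_pow_four_eq_prod, norm_prod, ← Finset.mul_prod_erase _ _ (Finset.mem_univ k₀)]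
  have hlow : (Real.sqrt 2 / 2) ^ 3 ≤ ∏ k ∈ Finset.univ.erase k₀, ‖q - ζ₀ * I ^ (k : ℕ)‖ := by
    have hcard : (Finset.univ.erase k₀ : Finset (Fin 4)).card = 3 := by
      rw [Finset.card_erase_of_mem (Finset.mem_univ _), Finset.card_univ, Fintype.card_fin]
    calc (Real.sqrt 2 / 2) ^ 3 = ∏ _k ∈ Finset.univ.erase k₀, (Real.sqrt 2 / 2 : ℝ) := by
          rw [Finset.prod_const, hcard]
      _ ≤ ∏ k ∈ Finset.univ.erase k₀, ‖q - ζ₀ * I ^ (k : ℕ)‖ :=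
          Finset.prod_le_prod (fun _ _ => hsqrt0.le) hother
  -- `(√2/2)³ ≥ 1/3`
  have hthird : (1 : ℝ) / 3 ≤ (Real.sqrt 2 / 2) ^ 3 := by
    have hs : Real.sqrt 2 ^ 2 = 2 := Real.sq_sqrt (by norm_num)
    have hs1 : (1.4 : ℝ) ≤ Real.sqrt 2 := by
      rw [show (1.4 : ℝ) = Real.sqrt (1.4 ^ 2) by rw [Real.sqrt_sq (by norm_num)]]
      exact Real.sqrt_le_sqrt (by norm_num)
    have : (Real.sqrt 2 / 2) ^ 3 = Real.sqrt 2 ^ 2 * Real.sqrt 2 / 8 := by ring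
    rw [this, hs]
    linarith
  calc d = 3 * (d * (1 / 3)) := by ring
    _ ≤ 3 * (d * ∏ k ∈ Finset.univ.erase k₀, ‖q - ζ₀ * I ^ (k : ℕ)‖) := by
        gcongr
        exact hthird.trans hlow
    _ = 3 * ‖q ^ 4 - ζ₀ ^ 4‖ := by rw [hprod]

/-! ## The Möbius chart `x ↦ (x + i)/(x − i)` -/

/-- For real `α`, `α − i ≠ 0`. [folklore] -/
theorem ofReal_sub_I_ne_zero (α : ℝ) : (α : ℂ) - I ≠ 0 := by
  intro h
  have := congrArg Complex.im h
  simp at this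

/-- **The Möbius chart.** For `z ≠ 0` and real `α`:
`‖z / z̄ − (α + i)/(α − i)‖ = 2·|Re z − α·Im z| / (‖z‖·‖α − i‖)` — the distance of `z/z̄` to the
circle point `(α+i)/(α−i)` measures the linear form `e − αf` (`z = e + fi`). [folklore] -/
theorem norm_div_conj_sub_moebius {z : ℂ} (hz : z ≠ 0) (α : ℝ) :
    ‖z / conj z - ((α : ℂ) + I) / ((α : ℂ) - I)‖ =
      2 * |z.re - α * z.im| / (‖z‖ * ‖(α : ℂ) - I‖) := by
  have hcz : conj z ≠ 0 := (map_ne_zero _).mpr hz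
  have hα : (α : ℂ) - I ≠ 0 := ofReal_sub_I_ne_zero α
  have key : z / conj z - ((α : ℂ) + I) / ((α : ℂ) - I) =
      (2 * I * (α * z.im - z.re : ℝ)) / (conj z * ((α : ℂ) - I)) := by
    rw [div_sub_div _ _ hcz hα]
    congr 1
    apply Complex.ext
    · simp
    · simp; ring
  rw [key, norm_div, norm_mul, norm_mul, norm_mul, Complex.norm_conj, Complex.norm_real,
    Real.norm_eq_abs, Complex.norm_I, mul_one, abs_sub_comm]
  norm_num

/-- The real parameter `α = 2·Im ζ/‖ζ − 1‖²` of a point `ζ ≠ 1` of the unit circle (the inverse of the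
Möbius chart) satisfies `(α : ℂ) = i(ζ + 1)/(ζ − 1)`. [folklore] -/
theorem alphaOf_eq {ζ : ℂ} (hζ : ‖ζ‖ = 1) (hζ1 : ζ ≠ 1) :
    ((2 * ζ.im / Complex.normSq (ζ - 1) : ℝ) : ℂ) = I * (ζ + 1) / (ζ - 1) := by
  have hne : ζ - 1 ≠ 0 := sub_ne_zero.mpr hζ1
  have hcirc : ζ.re * ζ.re + ζ.im * ζ.im = 1 := by
    rw [← Complex.normSq_apply, ← Complex.sq_norm, hζ, one_pow]
  -- on the circle `‖ζ − 1‖² = 2(1 − Re ζ)` and `Re ζ ≠ 1`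
  have hns : Complex.normSq (ζ - 1) = 2 * (1 - ζ.re) := by
    rw [Complex.normSq_apply]; simp; nlinarith [hcirc]
  have hre : ζ.re ≠ 1 := by
    intro h
    apply hζ1
    apply Complex.ext
    · simpa using h
    · have : ζ.im * ζ.im = 0 := by nlinarith [hcirc]
      simpa using this
  have hre' : 1 - ζ.re ≠ 0 := sub_ne_zero.mpr (Ne.symm hre)
  have ha : 2 * ζ.im / Complex.normSq (ζ - 1) = ζ.im / (1 - ζ.re) := by
    rw [hns]; field_simp
  rw [eq_div_iff hne, ha]
  set a : ℝ := ζ.im / (1 - ζ.re) with hadef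
  have ha1 : a * (1 - ζ.re) = ζ.im := by rw [hadef]; field_simp
  have ha2 : a * ζ.im = 1 + ζ.re := by
    have h3 : a * ζ.im * (1 - ζ.re) = (1 + ζ.re) * (1 - ζ.re) := by
      calc a * ζ.im * (1 - ζ.re) = a * (1 - ζ.re) * ζ.im := by ring
        _ = ζ.im * ζ.im := by rw [ha1]
        _ = (1 + ζ.re) * (1 - ζ.re) := by nlinarith [hcirc]
    exact mul_right_cancel₀ hre' h3
  apply Complex.ext
  · simp [Complex.mul_re]; linarith
  · simp [Complex.mul_im]; linarith

/-- **Inverse of the chart**: for `‖ζ‖ = 1`, `ζ ≠ 1` and `α = 2·Im ζ/‖ζ − 1‖²`,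
`(α + i)/(α − i) = ζ`. [folklore] -/
theorem moebius_alphaOf {ζ : ℂ} (hζ : ‖ζ‖ = 1) (hζ1 : ζ ≠ 1) :
    (((2 * ζ.im / Complex.normSq (ζ - 1) : ℝ) : ℂ) + I) /
      (((2 * ζ.im / Complex.normSq (ζ - 1) : ℝ) : ℂ) - I) = ζ := by
  have hne : ζ - 1 ≠ 0 := sub_ne_zero.mpr hζ1
  have hα := alphaOf_eq hζ hζ1
  have h1 : ((2 * ζ.im / Complex.normSq (ζ - 1) : ℝ) : ℂ) + I = 2 * I * ζ / (ζ - 1) := by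
    rw [hα, eq_div_iff hne, add_mul, div_mul_cancel₀ _ hne]; ring
  have h2 : ((2 * ζ.im / Complex.normSq (ζ - 1) : ℝ) : ℂ) - I = 2 * I / (ζ - 1) := by
    rw [hα, eq_div_iff hne, sub_mul, div_mul_cancel₀ _ hne]; ring
  rw [div_eq_iff (ofReal_sub_I_ne_zero _), h1, h2]
  ring

/-- **The chart preserves algebraicity**: if `ζ` (`‖ζ‖ = 1`, `ζ ≠ 1`) is algebraic over `ℚ` then so is
the real number `α = 2·Im ζ/‖ζ − 1‖²` (`= i(ζ+1)/(ζ−1)`; `i` is algebraic, `i² + 1 = 0` — cf.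
`Literature.Barriers.Schanuel.isAlgebraic_I`, re-proved inline to keep the imports light). [folklore] -/
theorem isAlgebraic_alphaOf {ζ : ℂ} (hζ : ‖ζ‖ = 1) (hζ1 : ζ ≠ 1) (halg : IsAlgebraic ℚ ζ) :
    IsAlgebraic ℚ (2 * ζ.im / Complex.normSq (ζ - 1)) := by
  have hI : IsAlgebraic ℚ I := by
    refine ⟨Polynomial.X ^ 2 + 1, ?_, ?_⟩
    · exact Polynomial.X_pow_add_C_ne_zero (by norm_num) 1
    · simp
  have hC : IsAlgebraic ℚ ((2 * ζ.im / Complex.normSq (ζ - 1) : ℝ) : ℂ) := by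
    rw [alphaOf_eq hζ hζ1, div_eq_mul_inv]
    refine (hI.mul (halg.add isAlgebraic_one)).mul ?_
    exact IsAlgebraic.inv_iff.mpr (halg.sub isAlgebraic_one)
  have hinj : Function.Injective (algebraMap ℝ ℂ) := Complex.ofReal_injective
  exact (isAlgebraic_algebraMap_iff hinj).mp hC

end Summit.ABC.ABC.Theorems.UniformSadicTowerFour.HarmonicThueRoth
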